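import Literature.MathematicalPhysics.QuantumFieldTheory.Balaban1983to89.B6BlockHolderGDivGEV1
import Literature.MathematicalPhysics.QuantumFieldTheory.Balaban1983to89.B6BlockDecayGradFactorsV1
import Literature.MathematicalPhysics.QuantumFieldTheory.Balaban1983to89.B5GlobCoverP12Lattice

/-!
# `Balaban1983to89.B6Block112DictionaryV1` — T. Bałaban, *Propagators and renormalization transformations for lattice gauge theories. II*,
# Commun. Math. Phys. **96** (1984) 223–250 [Balaban1984PropagatorsII], Prop. 2.5 p. 246 with [4] = *… I*, CMP **95** (1984) Prop. 1.2
# (1.112) p. 36: towards the member `|(∇G∇*J)(x)| ≤ O(1)e^{−δ₂|y−y′|}(‖J‖_ε + |J|)` for the two-scale `G` of (2.90) — [4] PROPOSITION 1.2,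
# MEMBER (1.112), FOR `G_k` BY NAME on B5's torus family of record, ALL SCALES, and the two DICTIONARIES (value of `∇_μG^{(w′)}∇_λ*x`, Hölder
# seminorm of the tensor source) towards the two-scale carriers — file M1a of the (1.112)/(1.113) members (p38 gen 22)

statement-level skeleton of published theorems with citation tags; proofs where landed; nothing here is a claim about the Yang–Mills mass gap

PDF held: `paper:balaban1984-cmp96-propagators-rt-ii` (journal page = PDF page + 222), p. 246 [PDF 24]; `paper:balaban1984-cmp95-propagators-rt-i` ([4],
journal page = PDF page + 16), p. 36 [PDF 20].  PRINT.  [4] p. 36 (verbatim, as quoted in the tree's `B5.Prop12Printed`): *"|(∇G∇*J)(x)| ≤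
O(1)e^{−δ₀|y−y′|}(‖J‖_ε + |J|) (1.112) for 0 < ε < 1, x ∈ Δ̃(y), supp J ⊂ Δ̃(y′), with the constant O(1) depending on d and ε (O(1) → ∞ if
ε → 0)"*; p. 36: *"The localized inequalities (1.110)–(1.114) imply immediately the following global inequalities"* [(1.115)–(1.117), among them
*"|∇G∇*J| ≤ O(1)(‖J‖_ε + |J|), (1.116)"*]; [B6] p. 246: *"From these representations we obtain all the necessary properties of the operators H_j,
G̃_j. They follow from the Proposition 1.2 …"*.

CITATION HEADER (lean-in-tree rule) — WHAT IS REPRODUCED.  Phase-2 file of the `lit-balaban` typed skeleton (HOME `run/shared/lean/pub/lit-balaban/`),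
seat **p38 gen 22** (B6 fold owner r03, referee ref-4; p22 g15 hand-off 2026-08-22T10:32Z of the (1.111)–(1.113) members), FILE M1a of the (1.112)/(1.113)
members of p22's Prop. 2.5 two-level decay programme for the genuine two-scale `G` of (2.90) (`…B6SectCTwoScaleV1Lattice.tsV1`, `Λ′` arbitrary,
`c = L^j`); SKELETON rows **B6.Prop2.5** / **B6.Eq2.131** and [4] **B5.Prop1.2** (cells only; decls of record untouched).  In the differentiated
representation (2.129), `∇_μG∇_λ* = (∇_μ∂H′_j)C(∇_λ∂H′_j)* + ∇_μG^{(w′)}∇_λ* − (∇_μH_j)(Q_jG^{(w′)}∇_λ*) + (∇_μH_j)C̃(∇_λH_j)* − (∇_μM)K₂∇_λ* −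
(∇_μK₂*)M∇_λ* + (∇_μK₂*)MK₂∇_λ*` (`M = G̃_j + H_jC̃H_j*`, `G̃_j = (I − H_jQ_j)G^{(w′)}`), every term but `∇_μG^{(w′)}∇_λ*` has a plain block bound
from landed factor bounds; the term `∇_μG^{(w′)}∇_λ*` is the only one that needs the Hölder norm `‖J‖_ε` of the source, and it is [4] (1.112)
FOR `G_k` BY NAME.  THIS FILE.  §1 **`e4L_allScales`**: [4] PROPOSITION 1.2, THE MEMBER (1.112), FOR `G_k = Δ_a⁻¹` ON B5's CARRIERS (r02's `e4L`:
`e4L a (.ten T) y = sup_{Δ̃(y)}|∇G_k∇*T|`, `holderL` = the (1.109) seminorm `‖T‖_ε`), ALL TORI, ALL SCALES `k ≤ m + K`, HYPOTHESIS-FREE — scales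
`k ≥ 1` = the `e4` clause of the tree's Prop. 1.2 on B5's torus family of record (`…B5Prop12GHolds.prop12_famG_printed`, re-indexed by p19's
`famG_reindex`), scale `0` (`e4L_le_one`) from the tree's hypothesis-free (1.114), member `‖ζ∇G∇*J‖` (`…B5Local114GLattice.l2locL_le_printed`,
`m = 3`) with the indicator cut-off of `Δ̃(y)` (p22's route for `m = 2` in `…B6BlockDecayGDivBridgeV1.eL_two_le_one`).  §2 THE VALUE DICTIONARY
**`DGEDadj_apply_eq`**: at `c = L^j`, `w′ = a·n^{d+1}`, `(∇_μG^{(w′)}∇_λ*x)(b₀) = Re (∇_μ(Δ_a⁻¹∇*T))(EK b₀₋, ν(b₀))` for the tensor source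
`T_ν = δ_{νλ}x^c` (this seat's `GE_Dadj_apply_eq`, p22's `Dop_comp_apply`, p19's `EK_shift`, r02's `grad`; `grad_apply_eq`).  §3 THE HÖLDER
DICTIONARY **`holderL_srcT_le`**: if `|x(b) − x(b′)| ≤ X_ε·(|b₋ − b₋′|_∞/n)^ε` on same-direction pairs with `|b₋ − b₋′|_∞ ≤ n` (`X_ε ≥ 0`), then
`‖T‖_ε ≤ X_ε` (r02's `holderT`, p19's `distU_EK`).  IMPORTS BY NAME, restating nothing.  THEOREMS ONLY (no `def`, no `def … : Prop`); standard
axioms.  HONEST SCOPE / DIVERGENCES. (1) `∇_μ`, `∇_λ*` = forward difference and its `ℓ²`-adjoint with the factor `η⁻¹ = L^j` (p22 files 8/12);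
the printed `∇G∇*J = ∇GΣ_ν∇_ν*J_ν` is recovered component by component (one `λ`, one `μ`). (2) [4] Prop. 1.2 enters PROVED
(`prop12_famG_printed`); the scale-`0` constant `constZero`/`delta114` (p19) is absorbed by `max`/`min`. (3) No new definition, no new hypothesis.
NOT summit progress.  Unit `lit-balaban-p38` (gen 22), 2026-08-22.
-/

noncomputable section

open scoped InnerProductSpace BigOperators Matrix
open Finset

namespace Literature.MathematicalPhysics.QuantumFieldTheory.Balaban1983to89.B6Block112DictionaryV1

open LatticeFieldCalculus B5SectBStatements B5Eq117TorusCarriers B6SectADomainsV1 B6SectAOperatorsV1 B6SectAVectorModelV1 B6SectCOperators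
  B6SectCTwoScaleV1 B6SectCTwoScaleV1Lattice B5Eq118OneStroke
open BalabanImbrieJaffe1984to88.BIJ85AxialPropagator411 (BondSpace)
open B4Sect5Torus (IsPseudoDist SumBound)
open B4TorusKernel.MultiPeriod (torusSupNorm torusSupNorm_nonneg)
open B4Sect5Proof (latticeConst latticeConst_nonneg)
open B5Prop11Plancherel (Tor fine unitVec fdiff)
open B5Prop11Lower (nsq nsq_nonneg)
open B5Prop11Lattice (divT l2T)
open B5Prop11SettingModel (Loc189 locNorm)
open B5DeltaA169 (DeltaA)
open B5Prop12FieldsLattice (distSite distU cubeT cubeB suppInL supNormL holderL holderT e4L l2locL cutInL cutSupL smulT)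
open B5SettingP12Real (LocR latticeSettingP12R)
open B5Prop12GLattice (famG)
open B5Local114GLattice (delta114 const114 delta114_pos const114_pos l2locL_le_printed)
open B5CoverP12Lattice (wP wP_nonneg wP_le_one wP_eq_zero_of_not_mem Lw Lw_nonneg)
open B5GlobCoverP12Lattice (pieceL piece_supp piece_sup piece_holder sum_pieces_ten grad_sum divT_sum smulT_sum)
open B5RowSumsP12Lattice (distSite_triangle distSite_comm)
open B6LowerBound2153Torus (rep)
open B3TorusRadialSums (supDist_comm)
open B6BlockDecayCalculus (torusDist_isPseudoDist torusDist_sumBound card_ball_le)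
open B6BlockDecayHprimeCovV1 (supDist_cast_eq_torusSupNorm)
open B6BlockDecayGradFactorsV1 (Dop_comp_apply)
open B6BlockHolderGDivGEV1 (GE_Dadj_apply_eq suppInL_srcT supNormL_srcT_le)
open BalabanImbrieJaffe1984to88.BIJ85Thm711TorusTransport (EK_shift)
open BalabanImbrieJaffe1984to88.BIJ85Prop12BridgeGeometry (supDist_cast_eq_distSite EK_mem_cubeT_blk distU_EK distSite_le_three_of_mem_mem two_le_Mk)
open BalabanImbrieJaffe1984to88.BIJ85Prop12BridgeZero (indCut cutInL_indCut indCut_of_mem cutSupL_indCut_le locNorm_le_supNormL constZero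
  constZero_nonneg)
open BalabanImbrieJaffe1984to88.BIJ85Prop12AllTori (famG_reindex)
open LatticeNorms (supNorm norm_le_supNorm supNorm_le supNorm_nonneg holderSeminorm holderSeminormB5 holderSeminorm_le holderSeminorm_nonneg)

/-! ## §1  [4] Proposition 1.2, the member (1.112), on B5's carriers: scale `0` from (1.114)₄, all scales from the family of record -/

section ScaleZero

variable {d : ℕ} {n : ℕ} [NeZero n] {M : Fin d → ℕ} [∀ μ, NeZero (M μ)] {a : ℝ}

/-- `|F_{s}(b)| ≤ ‖F‖` for a tensor field (a value below the `ℓ²` norm `l2T`). [cite: Balaban1984PropagatorsI, (1.114) p.36 (bookkeeping ours)] -/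
private theorem norm_apply_le_l2T {ι S : Type*} [Fintype ι] [Fintype S] (F : S → ι → ℂ) (p : S × ι) : ‖F p.1 p.2‖ ≤ l2T F := by
  unfold l2T
  refine Real.le_sqrt_of_sq_le ?_
  calc ‖F p.1 p.2‖ ^ 2 ≤ nsq (F p.1) := by
        unfold nsq
        exact Finset.single_le_sum (f := fun i => ‖F p.1 i‖ ^ 2) (fun i _ => sq_nonneg _) (Finset.mem_univ p.2)
    _ ≤ ∑ s, nsq (F s) := Finset.single_le_sum (f := fun s => nsq (F s)) (fun s _ => nsq_nonneg _) (Finset.mem_univ p.1)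

/-- **(1.112) AT `η = 1` FOR EVERY REAL SOURCE, WITHOUT THE HÖLDER TERM**: `sup_{Δ̃(y)}|∇G∇*J| ≤ O(1)e^{−δ₀|y−y′|}|J|`, `supp J ⊂ Δ̃(y′)`, with
`O(1) = constZero d a`, `δ₀ = delta114 d a` — from the tree's hypothesis-free (1.114), `m = 3` (`‖ζ∇G∇*J‖`), with the indicator cut-off of `Δ̃(y)`
(p22's route for `m = 2`, `…B6BlockDecayGDivBridgeV1.eL_two_le_one`). [cite: Balaban1984PropagatorsI, Prop. 1.2 (1.112) p.36, (1.114) p.36] -/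
theorem e4L_le_one (hn : n = 1) (ha : 0 < a) (J : LocR n M) (y y' : Tor M) (hJ : suppInL n M J.emb y') :
    e4L n M a J.emb y ≤ constZero d a * Real.exp (-(delta114 d a * distSite M y y')) * supNormL n M J.emb := by
  have hRHS : 0 ≤ constZero d a * Real.exp (-(delta114 d a * distSite M y y')) * supNormL n M J.emb := by
    have := constZero_nonneg d a
    have := B5Prop12FieldsLattice.supNormL_nonneg (n := n) (M := M) J.emb
    positivity
  cases J with
  | ten Tr =>
      show e4L n M a (Loc189.ten fun s b => (Tr s b : ℂ)) y ≤ _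
      rw [B5Prop12FieldsLattice.e4L_ten]
      refine supNorm_le hRHS fun p hp => ?_
      have hb1 : p.2.1 ∈ cubeT n M y := (Finset.mem_product.mp (Finset.mem_product.mp hp).2).1
      -- the value is the value of the cut tensor field, below its `ℓ²` norm = (1.114), m = 3
      have h1 : ‖B5Prop11Lattice.grad n M ((DeltaA n M a)⁻¹ *ᵥ divT n M fun s b => (Tr s b : ℂ)) p.1 p.2‖
          = ‖smulT n M (indCut n M y) (B5Prop11Lattice.grad n M ((DeltaA n M a)⁻¹ *ᵥ divT n M fun s b => (Tr s b : ℂ))) p.1 p.2‖ := by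
        simp only [smulT, indCut_of_mem n M hb1, Complex.ofReal_one, one_mul]
      have h2 := norm_apply_le_l2T (smulT n M (indCut n M y) (B5Prop11Lattice.grad n M ((DeltaA n M a)⁻¹ *ᵥ divT n M fun s b => (Tr s b : ℂ)))) p
      have h3 := l2locL_le_printed n M (by omega) ha 3 (Loc189.ten fun s b => (Tr s b : ℂ)) (indCut n M y)
        (cutInL_indCut n M y) hJ
      rw [B5Prop12FieldsLattice.l2locL_three_ten] at h3
      have h4 := locNorm_le_supNormL (M := M) hn a (LocR.ten Tr) hJ
      have h5 := cutSupL_indCut_le n M y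
      have hc := (const114_pos d a).le
      have hE : 0 ≤ Real.exp (-(delta114 d a * distSite M y y')) := (Real.exp_pos _).le
      have hsN : 0 ≤ supNormL n M (LocR.ten Tr : LocR n M).emb := B5Prop12FieldsLattice.supNormL_nonneg _
      rw [h1]
      calc ‖smulT n M (indCut n M y) (B5Prop11Lattice.grad n M ((DeltaA n M a)⁻¹ *ᵥ divT n M fun s b => (Tr s b : ℂ))) p.1 p.2‖
          ≤ l2T (smulT n M (indCut n M y) (B5Prop11Lattice.grad n M ((DeltaA n M a)⁻¹ *ᵥ divT n M fun s b => (Tr s b : ℂ)))) := h2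
        _ ≤ const114 d a * Real.exp (-(delta114 d a * distSite M y y')) * cutSupL n M (indCut n M y)
              * locNorm (Loc189.ten fun s b => (Tr s b : ℂ)) := h3
        _ ≤ const114 d a * Real.exp (-(delta114 d a * distSite M y y')) * 1
              * (Real.sqrt ((d : ℝ) ^ 3 * 3 ^ d) * supNormL n M (LocR.ten Tr : LocR n M).emb) := by
            gcongr
            · exact B5Prop11SettingModel.locNorm_nonneg _
            · exact h4
        _ = constZero d a * Real.exp (-(delta114 d a * distSite M y y')) * supNormL n M (LocR.ten Tr : LocR n M).emb := by
            unfold constZero; ring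
  | vec Jr =>
      have h0 : e4L n M a (LocR.vec Jr : LocR n M).emb y = 0 := rfl
      rw [h0]; exact hRHS
  | ten2 Jr =>
      have h0 : e4L n M a (LocR.ten2 Jr : LocR n M).emb y = 0 := rfl
      rw [h0]; exact hRHS

end ScaleZero

section AllScales

/-- decay weakening with a non-negative extra term: `C e^{−δ₀ D} X ≤ C′ e^{−δ D} (H + X)` for `δ ≤ δ₀`, `C ≤ C′`, `0 ≤ C′`, `D, X, H ≥ 0`.
[cite: Balaban1984PropagatorsI, Prop. 1.2 (1.112) p.36 (constants bookkeeping, ours)] -/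
private theorem weaken112 {C C' δ₀ δ D X H : ℝ} (hCC : C ≤ C') (hC' : 0 ≤ C') (hδ : δ ≤ δ₀) (hD : 0 ≤ D) (hX : 0 ≤ X) (hH : 0 ≤ H) :
    C * Real.exp (-(δ₀ * D)) * X ≤ C' * Real.exp (-(δ * D)) * (H + X) := by
  have h1 : Real.exp (-(δ₀ * D)) ≤ Real.exp (-(δ * D)) := Real.exp_le_exp.mpr (by nlinarith)
  have h2 : C * Real.exp (-(δ₀ * D)) ≤ C' * Real.exp (-(δ * D)) :=
    (mul_le_mul_of_nonneg_right hCC (Real.exp_pos _).le).trans (mul_le_mul_of_nonneg_left h1 hC')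
  have h3 : 0 ≤ C' * Real.exp (-(δ * D)) := mul_nonneg hC' (Real.exp_pos _).le
  calc C * Real.exp (-(δ₀ * D)) * X ≤ C' * Real.exp (-(δ * D)) * X := mul_le_mul_of_nonneg_right h2 hX
    _ ≤ C' * Real.exp (-(δ * D)) * (H + X) := mul_le_mul_of_nonneg_left (by linarith) h3

/-- **[4] PROPOSITION 1.2, THE MEMBER (1.112) FOR `G_k = Δ_a⁻¹`, ALL TORI OF DIMENSION `d` AND BLOCK SIZE `L`, ALL SCALES `k ≤ m + K`,
HYPOTHESIS-FREE**: ONE `δ₀ > 0` and ONE `O(1)(ε) ≥ 0` (depending on `d, L, a` only) such that for every torus `P` (`P.d = d`, `P.L = L`), every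
`k ≤ m + K`, every `0 < ε < 1`, every real source `J` with `supp J ⊂ Δ̃(y′)`:
`sup_{Δ̃(y)}|∇G_k∇*J| ≤ O(1)(ε)e^{−δ₀|y−y′|}(‖J‖_ε + |J|)` on B5's carriers (r02's `e4L`, genuine on tensor sources, `0` on the others; `holderL` =
(1.109)) — scales `k ≥ 1` from the tree's Prop. 1.2 on B5's torus family of record (`prop12_famG_printed`, member `e4`, p19's `famG_reindex`), scale `0`
from `e4L_le_one`. [cite: Balaban1984PropagatorsI, Prop. 1.2 (1.112) p.36, pp.39–40 («Thus we have finished the proof of Proposition 1.2.»)] -/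
theorem e4L_allScales (d L : ℕ) {a : ℝ} (ha : 0 < a) :
    ∃ δ : ℝ, 0 < δ ∧ ∃ Cε : ℝ → ℝ, (∀ ε, 0 ≤ Cε ε) ∧ ∀ (P : Params) (_ : P.d = d) (_ : P.L = L) (k : ℕ) (_ : k ≤ P.m + P.K)
      (ε : ℝ) (_ : 0 < ε) (_ : ε < 1) (J : LocR (P.L ^ k) (Mk P k)) (y y' : Tor (Mk P k)), suppInL (P.L ^ k) (Mk P k) J.emb y' →
      e4L (P.L ^ k) (Mk P k) a J.emb y ≤
        Cε ε * Real.exp (-(δ * distSite (Mk P k) y y')) * (holderL (P.L ^ k) (Mk P k) ε J.emb + supNormL (P.L ^ k) (Mk P k) J.emb) := by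
  by_cases h : 1 ≤ d ∧ (Odd L ∧ 1 < L)
  · obtain ⟨δ₁, C₁, Cα₁, Cε₁, Cαε₁, hδ₁, hC₁, H₁⟩ := B5Prop12GHolds.prop12_famG_printed (d := d) (L := L) h.1 h.2 ha
    refine ⟨min δ₁ (delta114 d a), lt_min hδ₁ (delta114_pos d ha), fun ε => max (Cε₁ ε) (constZero d a),
      fun ε => le_max_of_le_right (constZero_nonneg d a), ?_⟩
    intro P hPd hPL k hk ε hε0 hε1 J y y' hJ
    subst hPd; subst hPL
    have hD : 0 ≤ distSite (Mk P k) y y' := B5Prop12FieldsLattice.distSite_nonneg _ _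
    have hS : 0 ≤ supNormL (P.L ^ k) (Mk P k) J.emb := B5Prop12FieldsLattice.supNormL_nonneg _
    have hHo : 0 ≤ holderL (P.L ^ k) (Mk P k) ε J.emb := B5Prop12FieldsLattice.holderL_nonneg _ _
    have hmax : 0 ≤ max (Cε₁ ε) (constZero P.d a) := le_max_of_le_right (constZero_nonneg P.d a)
    rcases Nat.eq_zero_or_pos k with rfl | hk1
    · -- scale 0: η = L⁰ = 1, no Hölder term needed
      have h0 := e4L_le_one (d := P.d) (M := Mk P 0) (n := P.L ^ 0) (pow_zero _) ha J y y' hJ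
      exact h0.trans (weaken112 (le_max_right _ _) hmax (min_le_right _ _) hD hS hHo)
    · -- scale k ≥ 1: the member ⟨d, L, m+K−k, k⟩ of the torus family of record
      have H := H₁ ⟨⟨P.d, P.L, P.m + P.K - k, k, P.hd, P.hL⟩, rfl, rfl, hk1⟩
      rw [famG_reindex] at H
      obtain ⟨-, -, He4, -, -⟩ := H
      have h1 := He4 ε J y y' hε0 hε1 hJ
      change e4L (P.L ^ k) (Mk P k) a J.emb y ≤ Cε₁ ε * Real.exp (-(δ₁ * distSite (Mk P k) y y')) *
        (holderL (P.L ^ k) (Mk P k) ε J.emb + supNormL (P.L ^ k) (Mk P k) J.emb) at h1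
      refine h1.trans ?_
      have e1 : Real.exp (-(δ₁ * distSite (Mk P k) y y')) ≤ Real.exp (-(min δ₁ (delta114 P.d a) * distSite (Mk P k) y y')) :=
        Real.exp_le_exp.mpr (by nlinarith [min_le_left δ₁ (delta114 P.d a)])
      have e2 : Cε₁ ε * Real.exp (-(δ₁ * distSite (Mk P k) y y')) ≤ max (Cε₁ ε) (constZero P.d a) * Real.exp (-(min δ₁ (delta114 P.d a) * distSite (Mk P k) y y')) :=
        (mul_le_mul_of_nonneg_right (le_max_left _ _) (Real.exp_pos _).le).trans (mul_le_mul_of_nonneg_left e1 hmax)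
      exact mul_le_mul_of_nonneg_right e2 (by positivity)
  · -- no torus has `d = 0` or an inadmissible `L`: the range is empty
    refine ⟨1, one_pos, fun _ => 0, fun _ => le_rfl, fun P hPd hPL k hk ε hε0 hε1 J y y' hJ => ?_⟩
    exact (h ⟨hPd ▸ P.hd, hPL ▸ P.hL⟩).elim

end AllScales

/-! ## §2  The value dictionary: `(∇_μG^{(w′)}∇_λ*x)(b₀) = Re (∇_μ(Δ_a⁻¹∇*T))(EK b₀₋, ν(b₀))`, `T_ν = δ_{νλ}x^c` -/

section Transport

variable {d L m K : ℕ} [NeZero L] {hd : 1 ≤ d + 1} {hL : Odd L ∧ 1 < L} {j : ℕ}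
  (hj' : j ≤ (⟨d + 1, L, m, K, hd, hL⟩ : Params).m + (⟨d + 1, L, m, K, hd, hL⟩ : Params).K)
  (hc : ((L : ℝ) ^ j) ≠ 0) {a : ℝ} (ha : 0 < a) (hw' : (0 : ℝ) < a * ((L : ℝ) ^ j) ^ (d + 1))

/-- `(∇_μF)_κ(s) = n·(F_κ(s + e_μ) − F_κ(s))` for r02's `grad` (componentwise forward difference with the factor `n = η⁻¹`).
[cite: Balaban1984PropagatorsI, (1.31) p.23, (1.4) p.18] -/
theorem grad_apply_eq {n : ℕ} [NeZero n] {M : Fin (d + 1) → ℕ} [∀ μ, NeZero (M μ)] (F : Tor (fine n M) × Fin (d + 1) → ℂ) (mu : Fin (d + 1))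
    (s : Tor (fine n M)) (κ : Fin (d + 1)) :
    B5Prop11Lattice.grad n M F mu (s, κ) = (n : ℂ) * (F (s + unitVec (fine n M) mu, κ) - F (s, κ)) := by
  unfold B5Prop11Lattice.grad
  rw [B5CombesThomasLattice.fdiff_apply]
  rfl

include ha in
/-- **THE VALUE DICTIONARY**: at `c = L^j`, `w′ = a·n^{d+1}`, for a fine bond field `x`, directions `λ, μ` and a fine bond `b₀`,
`(∇_μG^{(w′)}∇_λ*x)(b₀) = Re (∇_μ(Δ_a⁻¹∇*T))(EK b₀₋, ν(b₀))` with the complexified tensor source `T_ν(b) = δ_{νλ}·x(EK⁻¹b₋, ν(b))` — this seat's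
`GE_Dadj_apply_eq` at `b₀` and `b₀ + e_μ`, p22's `Dop_comp_apply`, p19's `EK_shift`, r02's `grad`. [cite: Balaban1984PropagatorsI, (1.89) p.33 («∇G∇*J»), (1.112) p.36; Balaban1984PropagatorsII, p.246] -/
theorem DGEDadj_apply_eq (lam mu : Fin (d + 1)) (x : BondSpace (⟨d + 1, L, m, K, hd, hL⟩ : Params)) (b₀ : PBond (⟨d + 1, L, m, K, hd, hL⟩ : Params) 0) :
    (((((L : ℝ) ^ j) • (onE (LinearMap.funLeft ℝ ℝ (fun b : PBond (⟨d + 1, L, m, K, hd, hL⟩ : Params) 0 => (⟨b.src.shift mu, b.dir⟩ : PBond (⟨d + 1, L, m, K, hd, hL⟩ : Params) 0))) - LinearMap.id) : BondSpace (⟨d + 1, L, m, K, hd, hL⟩ : Params) →ₗ[ℝ] BondSpace (⟨d + 1, L, m, K, hd, hL⟩ : Params))) ∘ₗ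
      (GE (Domains.whole (P := (⟨d + 1, L, m, K, hd, hL⟩ : Params)) j hj') hc (w := fun _ => a * ((L : ℝ) ^ j) ^ (d + 1)) (fun _ => hw') ∘ₗ ((((L : ℝ) ^ j) • (onE (LinearMap.funLeft ℝ ℝ (fun b : PBond (⟨d + 1, L, m, K, hd, hL⟩ : Params) 0 => (⟨b.src.unshift lam, b.dir⟩ : PBond (⟨d + 1, L, m, K, hd, hL⟩ : Params) 0))) - LinearMap.id) : BondSpace (⟨d + 1, L, m, K, hd, hL⟩ : Params) →ₗ[ℝ] BondSpace (⟨d + 1, L, m, K, hd, hL⟩ : Params))))) x b₀ =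
      (B5Prop11Lattice.grad (L ^ j) (Mk (⟨d + 1, L, m, K, hd, hL⟩ : Params) j)
        ((DeltaA (L ^ j) (Mk (⟨d + 1, L, m, K, hd, hL⟩ : Params) j) a)⁻¹ *ᵥ divT (L ^ j) (Mk (⟨d + 1, L, m, K, hd, hL⟩ : Params) j)
          (fun ν b => ((if ν = lam then x ⟨(EK hj').symm b.1, b.2⟩ else 0 : ℝ) : ℂ))) mu (EK hj' b₀.src, b₀.dir)).re := by
  rw [Dop_comp_apply, GE_Dadj_apply_eq hj' hc ha hw', GE_Dadj_apply_eq hj' hc ha hw', grad_apply_eq]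
  have hE : EK hj' (b₀.src.shift mu) = EK hj' b₀.src + unitVec (fine (L ^ j) (Mk (⟨d + 1, L, m, K, hd, hL⟩ : Params) j)) mu :=
    EK_shift (P := (⟨d + 1, L, m, K, hd, hL⟩ : Params)) hj' b₀.src mu
  have hcast : (((L ^ j : ℕ) : ℂ)) = (((L : ℝ) ^ j : ℝ) : ℂ) := by push_cast; ring
  rw [show ((⟨b₀.src.shift mu, b₀.dir⟩ : PBond (⟨d + 1, L, m, K, hd, hL⟩ : Params) 0).src) = b₀.src.shift mu from rfl,
    show ((⟨b₀.src.shift mu, b₀.dir⟩ : PBond (⟨d + 1, L, m, K, hd, hL⟩ : Params) 0).dir) = b₀.dir from rfl, hE, hcast,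
    ← Complex.sub_re, Complex.re_ofReal_mul]

/-! ## §3  The Hölder dictionary: the (1.109) seminorm of the tensor source `T_ν = δ_{νλ}x^c` -/

/-- **THE HÖLDER DICTIONARY**: if `|x(b) − x(b′)| ≤ X_ε·(|b₋ − b₋′|_∞/n)^ε` for all fine bonds of the same direction with `|b₋ − b₋′|_∞ ≤ n`
(`n = L^j`; `X_ε ≥ 0`), then r02's (1.109) seminorm of the tensor source satisfies `‖T‖_ε ≤ X_ε` (`holderL … (.ten T) = holderT`: pairs with the
same `ν` and the same component at `0 < |s − s′| ≤ 1` unit; p19's `distU_EK`). [cite: Balaban1984PropagatorsI, (1.109) p.35, (1.112) p.36 («‖J‖_ε»)] -/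
theorem holderL_srcT_le (lam : Fin (d + 1)) (x : BondSpace (⟨d + 1, L, m, K, hd, hL⟩ : Params)) {ε Xε : ℝ} (hXε : 0 ≤ Xε)
    (hH : ∀ b b' : PBond (⟨d + 1, L, m, K, hd, hL⟩ : Params) 0, b.dir = b'.dir → supDist b.src b'.src ≤ L ^ j →
      |x b - x b'| ≤ Xε * (((supDist b.src b'.src : ℕ) : ℝ) / (L : ℝ) ^ j) ^ ε) :
    holderL (L ^ j) (Mk (⟨d + 1, L, m, K, hd, hL⟩ : Params) j) ε
      (LocR.ten (fun ν b => if ν = lam then x ⟨(EK hj').symm b.1, b.2⟩ else 0) : LocR (L ^ j) (Mk (⟨d + 1, L, m, K, hd, hL⟩ : Params) j)).emb ≤ Xε := by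
  have hLj : (0 : ℝ) < (L : ℝ) ^ j := pow_pos (Nat.cast_pos.2 (Nat.pos_of_ne_zero (NeZero.ne L))) _
  show holderT (L ^ j) (Mk (⟨d + 1, L, m, K, hd, hL⟩ : Params) j) ε (fun ν b => ((if ν = lam then x ⟨(EK hj').symm b.1, b.2⟩ else 0 : ℝ) : ℂ)) ≤ Xε
  unfold holderT holderSeminormB5
  refine holderSeminorm_le hXε fun p _ p' _ hadm hpos => ?_
  obtain ⟨⟨hν, hκ⟩, hle1⟩ := hadm
  -- the pair of fine bonds `⟨EK⁻¹ s, κ⟩`, `⟨EK⁻¹ s′, κ⟩`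
  have hdU : distU (L ^ j) (Mk (⟨d + 1, L, m, K, hd, hL⟩ : Params) j) p.2.1 p'.2.1 =
      ((supDist ((EK hj').symm p.2.1) ((EK hj').symm p'.2.1) : ℕ) : ℝ) / (L : ℝ) ^ j := by
    rw [← distU_EK hj', Equiv.apply_symm_apply, Equiv.apply_symm_apply]
  have hsd : supDist ((EK hj').symm p.2.1) ((EK hj').symm p'.2.1) ≤ L ^ j := by
    have h1 : ((supDist ((EK hj').symm p.2.1) ((EK hj').symm p'.2.1) : ℕ) : ℝ) / (L : ℝ) ^ j ≤ 1 := by rw [← hdU]; exact hle1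
    rw [div_le_one hLj] at h1
    exact_mod_cast h1
  by_cases hνl : p.1 = lam
  · have hν'l : p'.1 = lam := hν ▸ hνl
    have key := hH ⟨(EK hj').symm p'.2.1, p'.2.2⟩ ⟨(EK hj').symm p.2.1, p.2.2⟩ hκ.symm
      (by show supDist ((EK hj').symm p'.2.1) ((EK hj').symm p.2.1) ≤ L ^ j; rw [supDist_comm]; exact hsd)
    rw [show supDist ((⟨(EK hj').symm p'.2.1, p'.2.2⟩ : PBond (⟨d + 1, L, m, K, hd, hL⟩ : Params) 0).src)
        ((⟨(EK hj').symm p.2.1, p.2.2⟩ : PBond (⟨d + 1, L, m, K, hd, hL⟩ : Params) 0).src) = supDist ((EK hj').symm p.2.1) ((EK hj').symm p'.2.1) from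
      supDist_comm _ _, ← hdU] at key
    rw [show (id (((if p'.1 = lam then x ⟨(EK hj').symm p'.2.1, p'.2.2⟩ else 0 : ℝ) : ℂ)) - (((if p.1 = lam then x ⟨(EK hj').symm p.2.1, p.2.2⟩ else 0 : ℝ) : ℂ)))
        = (((x ⟨(EK hj').symm p'.2.1, p'.2.2⟩ - x ⟨(EK hj').symm p.2.1, p.2.2⟩ : ℝ) : ℂ)) by
      rw [id, if_pos hνl, if_pos hν'l, Complex.ofReal_sub], Complex.norm_real, Real.norm_eq_abs]
    exact key
  · have hν'l : ¬ p'.1 = lam := fun h' => hνl (hν.trans h')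
    rw [show (id (((if p'.1 = lam then x ⟨(EK hj').symm p'.2.1, p'.2.2⟩ else 0 : ℝ) : ℂ)) - (((if p.1 = lam then x ⟨(EK hj').symm p.2.1, p.2.2⟩ else 0 : ℝ) : ℂ))) = 0 by
      rw [id, if_neg hνl, if_neg hν'l, Complex.ofReal_zero, sub_zero], norm_zero]
    exact mul_nonneg hXε (Real.rpow_nonneg hpos.le ε)

end Transport

end Literature.MathematicalPhysics.QuantumFieldTheory.Balaban1983to89.B6Block112DictionaryV1

end
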